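import Summits.Ventures.CertifiedArithmetic.LowPrec.SRPythagorasLiabilityWindows
import HarnessLib

/-!
# CXXV — The liability potential (VI): the TOP-CELL cases of the two-point inequality in cell-data
# form — a representable point, or a point of a narrow cell, against a point of a `G`-cell

HONEST FRAMING: certified error envelopes and provably optimal rounding/accumulation schemes for
low-precision formats under stated cost models; every table by two implementations; no hardware or
vendor claims.

Sixth file of the liability series.  CXXII `pairLE_exact_top` and CXXIII `pairLE_fine_top` prove the
two-point inequality `PairLE F (probAwayA N) G E c c'` (`E = G/2^N`) for a phase-keeping point `c` below
a point `c'` of the top run of a `TwoRunWindow`.  Their proofs use nothing about the window except the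
CELL DATA of the two points: `c'` lies in a cell that is trivial or `G = 2^N·E` wide (so both of its
candidates read the same residue modulo `E` against any point below, and its StochasticA truncation is
`(c' − ⌊c̄'⌋) mod E`), and `c` is representable (`pairLE_exact_topA`) or lies strictly inside a cell
`[d, d + f]` below `⌊c̄'⌋` whose width `f ≤ G` is dyadically related to `E` and whose base point is
congruent to `⌊c̄'⌋` modulo `f` (`pairLE_fine_topA`, `N ≥ 1`).  This file states and proves exactly
these data-form versions, for any value set `F` over any linearly ordered field — the form in which the
one-signed windows of a binary FORMAT (top binade of width `G`, phase-keeping points in the binades of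
width `< E` and representable points anywhere below) can use them, for every `N ≥ 1` and every distance
between the two points.  No new definitions, no `sorry`; nothing format-specific is claimed here.
References: [ConnollyHighamMary2021], [ElararEtAl2025], [FitzgibbonFelix2025].
-/

namespace Summit.Ventures.CertifiedArithmetic.LowPrec.SR

open Literature.ComputerArithmetic.ConnollyHighamMary2021
open Finset

variable {K : Type*} [Field K] [LinearOrder K] [IsStrictOrderedRing K] [FloorRing K]

namespace LimitedBits

/-- **Representable point below a point of a `G`-cell** (cell-data form of CXXII `pairLE_exact_top`):
`c` representable, `c ≤ ⌊c̄'⌋`, the cell of `c'` trivial or `G = 2^N E` wide with `0 ≤ ⌊c̄'⌋`: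
`PairLE F (probAwayA N) G E c c'`, every `N`. -/
theorem pairLE_exact_topA (F : Finset K) (N : ℕ) {G E c c' : K} (hE : 0 < E) (hGE : G = 2 ^ N * E)
    (hc' : InHull F c') (hd0' : 0 ≤ dn F c')
    (he : up F c = dn F c) (hd : dn F c = c) (hcd' : c ≤ dn F c')
    (hwc' : up F c' = dn F c' ∨ up F c' = dn F c' + G) (hdc' : dn F c' ≤ c') (hcu' : c' ≤ up F c') :
    PairLE F (probAwayA N) G E c c' := by
  have hq01 : ∀ θ : K, 0 ≤ θ → θ ≤ 1 → 0 ≤ probAwayA N θ ∧ probAwayA N θ ≤ 1 :=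
    fun θ h0 h1 => probAwayA_mem N θ h0 h1
  have hu : up F c = c := he.trans hd
  have hcc : c ≤ c' := hcd'.trans hdc'
  have hy : truncQ F (probAwayA N) c = 0 := by unfold truncQ stepQ; rw [hu, hd]; ring
  have hy' : truncQ F (probAwayA N) c' = resid (c' - dn F c') E := by
    unfold truncQ; rw [stepQA_cell F N hc' hd0' hE (by rwa [← hGE])]; ring
  -- both children of c' read the same residue ψ = (c − ⌊c̄'⌋) mod E against c
  have hψb := resid_nonneg_lt (y := c - dn F c') hE
  have hres : resid (c - up F c') E = resid (c - dn F c') E := by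
    rcases hwc' with h | h
    · rw [h]
    · rw [h, show c - (dn F c' + G) = (c - dn F c') + ((-(2 ^ N) : ℤ) : K) * E by
        push_cast; linear_combination (-1 : K) * hGE, resid_add_mul hE]
  have hlu : pairLiab E c (up F c') = (up F c' - c) * resid (c - dn F c') E := by
    unfold pairLiab
    rw [abs_of_nonpos (by linarith [dn_le_up F c']), neg_neg, hres]; ring
  have hld : pairLiab E c (dn F c') = (dn F c' - c) * resid (c - dn F c') E := by
    unfold pairLiab; rw [abs_of_nonpos (by linarith), neg_neg]; ring
  have h0 : pairStepQ F (probAwayA N) E c c'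
      = (stepQ F (probAwayA N) c' (fun t => t) - c) * resid (c - dn F c') E := by
    simp only [pairStepQ, stepQ]; rw [hd, hu, hlu, hld]; ring
  have hm' : stepQ F (probAwayA N) c' (fun t => t) = c' - truncQ F (probAwayA N) c' := by
    unfold truncQ; ring
  -- cost domination in the sharp form
  have hcd := costdom (D := dn F c') hE hcc (0 : K)
  rw [← hy'] at hcd
  have hyb' := resid_nonneg_lt (y := c' - dn F c') hE
  rw [← hy'] at hyb'
  have hG0 : 0 ≤ G := by rw [hGE]; positivity
  have hwG' : up F c' - dn F c' ≤ G := by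
    rcases hwc' with h | h
    · rw [h, sub_self]; exact hG0
    · rw [h]; linarith
  have hV' := vslackQ_nonneg F hq01 (sub_nonneg.mpr (dn_le_up F c')) hwG'
  unfold PairLE
  rw [h0, hm', hy]
  unfold vslackQ at hV' ⊢
  rw [hu, hd]
  linarith [hcd, hV', mul_nonneg hyb'.1 hψb.1, mul_nonneg hE.le (sub_nonneg.mpr hyb'.2.le),
    sq_nonneg G, sq_nonneg E]

set_option maxHeartbeats 1600000 in
/-- **Point of a narrow cell below a point of a `G`-cell** (cell-data form of CXXIII `pairLE_fine_top`,
`N ≥ 1`): `c` strictly inside a cell `[d, d + f]` with `0 ≤ d`, `f ≤ G = 2^N E`, `f` dyadically related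
to `E` (`f ∈ 2^ℕ·E` or `E ∈ 2^ℕ·f` with `f < E`), the whole cell below `⌊c̄'⌋` and `d ≡ ⌊c̄'⌋ (mod f)`;
`c'` in a cell that is trivial or `G` wide with `0 ≤ ⌊c̄'⌋`: `PairLE F (probAwayA N) G E c c'`. -/
theorem pairLE_fine_topA (F : Finset K) {N : ℕ} (hN : 1 ≤ N) {G E f c c' : K} (hE : 0 < E)
    (hGE : G = 2 ^ N * E) (hf : 0 < f) (hfG : f ≤ G)
    (hdiv : (∃ d : ℕ, f = 2 ^ d * E) ∨ (∃ m : ℕ, E = 2 ^ m * f ∧ f < E))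
    (hc : InHull F c) (hd0 : 0 ≤ dn F c) (hc' : InHull F c') (hd0' : 0 ≤ dn F c')
    (hu : up F c = dn F c + f) (hdlt : dn F c < c) (hult : c < up F c)
    (hud' : up F c ≤ dn F c') (hdd : ∃ z : ℤ, dn F c - dn F c' = z * f)
    (hwc' : up F c' = dn F c' ∨ up F c' = dn F c' + G) (hdc' : dn F c' ≤ c') (hcu' : c' ≤ up F c') :
    PairLE F (probAwayA N) G E c c' := by
  have hq01 : ∀ θ : K, 0 ≤ θ → θ ≤ 1 → 0 ≤ probAwayA N θ ∧ probAwayA N θ ≤ 1 :=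
    fun θ h0 h1 => probAwayA_mem N θ h0 h1
  have h2N : (2 : K) ≤ 2 ^ N :=
    calc (2 : K) = 2 ^ 1 := by norm_num
      _ ≤ 2 ^ N := pow_le_pow_right₀ (by norm_num) hN
  have h2N0 : (0 : K) < 2 ^ N := by positivity
  obtain ⟨zd, hzd⟩ := hdd
  have huf : (0 : K) < f / 2 ^ N := by positivity
  have hy : truncQ F (probAwayA N) c = resid (c - dn F c) (f / 2 ^ N) := by
    unfold truncQ
    rw [stepQA_cell F N hc hd0 huf (Or.inr (by rw [hu]; field_simp))]; ring
  have hy' : truncQ F (probAwayA N) c' = resid (c' - dn F c') E := by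
    unfold truncQ; rw [stepQA_cell F N hc' hd0' hE (by rwa [← hGE])]; ring
  have hcc : c < c' := lt_of_lt_of_le (lt_of_lt_of_le hult hud') hdc'
  have hud'' : dn F c + f ≤ dn F c' := by rw [← hu]; exact hud'
  have hdd' : dn F c ≤ dn F c' := by linarith
  -- liabilities of a point `a ≤ ⌊c̄'⌋` against the two candidates of `c'`
  have hres : ∀ a, a ≤ dn F c' →
      pairLiab E a (up F c') = (up F c' - a) * resid (a - dn F c') E ∧
        pairLiab E a (dn F c') = (dn F c' - a) * resid (a - dn F c') E := by
    intro a ha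
    have hr : resid (a - up F c') E = resid (a - dn F c') E := by
      rcases hwc' with h | h
      · rw [h]
      · rw [h, show a - (dn F c' + G) = (a - dn F c') + ((-(2 ^ N) : ℤ) : K) * E by
          push_cast; linear_combination (-1 : K) * hGE, resid_add_mul hE]
    constructor
    · unfold pairLiab; rw [abs_of_nonpos (by linarith [dn_le_up F c']), neg_neg, hr]; ring
    · unfold pairLiab; rw [abs_of_nonpos (by linarith), neg_neg]; ring
  -- the pair step
  have h0 : pairStepQ F (probAwayA N) E c c'
      = pUpQ F (probAwayA N) c
          * ((pUpQ F (probAwayA N) c' * up F c' + (1 - pUpQ F (probAwayA N) c') * dn F c'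
              - (dn F c + f)) * resid (dn F c + f - dn F c') E)
        + (1 - pUpQ F (probAwayA N) c)
          * ((pUpQ F (probAwayA N) c' * up F c' + (1 - pUpQ F (probAwayA N) c') * dn F c'
              - dn F c) * resid (dn F c - dn F c') E) := by
    simp only [pairStepQ, stepQ]
    rw [hu, (hres _ hud'').1, (hres _ hud'').2, (hres _ hdd').1, (hres _ hdd').2]; ring
  have hm' : pUpQ F (probAwayA N) c' * up F c' + (1 - pUpQ F (probAwayA N) c') * dn F c'
      = c' - truncQ F (probAwayA N) c' := by
    unfold truncQ stepQ; ring
  obtain ⟨hp0, hp1⟩ := pUpQ_mem F hq01 c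
  obtain ⟨hp0', hp1'⟩ := pUpQ_mem F hq01 c'
  have hMge : dn F c + f ≤ c' - truncQ F (probAwayA N) c' := by
    rw [← hm']
    have := mul_nonneg hp0' (sub_nonneg.mpr (hdc'.trans hcu'))
    linarith
  -- truncation bounds and variance slacks
  have hyb := resid_nonneg_lt (y := c - dn F c) huf
  rw [← hy] at hyb
  have hyb' := resid_nonneg_lt (y := c' - dn F c') hE
  rw [← hy'] at hyb'
  have hufE : f / 2 ^ N ≤ E := by
    rw [div_le_iff₀ h2N0]; linarith
  have hG0 : 0 ≤ G := by rw [hGE]; positivity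
  have hwG' : up F c' - dn F c' ≤ G := by
    rcases hwc' with h | h
    · rw [h, sub_self]; exact hG0
    · rw [h]; linarith
  have hw : up F c - dn F c = f := by rw [hu]; ring
  have hV := vslackQ_nonneg F hq01 (c := c) (G := G) (sub_nonneg.mpr (dn_le_up F c))
    (by rw [hw]; exact hfG)
  have hV' := vslackQ_nonneg F hq01 (sub_nonneg.mpr (dn_le_up F c')) hwG'
  -- cost domination against `⌊c̄'⌋`
  have hcd := costdom (D := dn F c') hE hcc.le (truncQ F (probAwayA N) c)
  rw [← hy'] at hcd
  have hj : dn F c - dn F c' = resid (dn F c - dn F c') E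
      + (⌊(dn F c - dn F c') / E⌋ : ℤ) * E := by
    unfold resid; ring
  have hr0 := resid_nonneg_lt (y := dn F c - dn F c') hE
  rcases hdiv with ⟨d, hd⟩ | ⟨m, hm, hfE⟩
  · -- (i) `f` is a multiple of `E`: both residues vanish and `y ≤ φ`
    have hdd : dn F c - dn F c' = ((zd * 2 ^ d : ℤ) : K) * E := by
      push_cast; rw [hzd, hd]; ring
    have hψ0 : resid (dn F c - dn F c') E = 0 := by rw [hdd, resid_int_mul hE]
    have hψ1 : resid (dn F c + f - dn F c') E = 0 := by
      have hdd' := hdd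
      push_cast at hdd'
      rw [show dn F c + f - dn F c' = ((zd * 2 ^ d + 2 ^ d : ℤ) : K) * E by
            push_cast; linear_combination hdd' + hd, resid_int_mul hE]
    have hφ : resid (c - dn F c') E = resid (c - dn F c) E := by
      rw [show c - dn F c' = (c - dn F c) + ((zd * 2 ^ d : ℤ) : K) * E by linear_combination hdd,
        resid_add_mul hE]
    have hdN : d ≤ N := by
      by_contra h; push Not at h
      have h1 : (2 : K) ^ N < 2 ^ d := pow_lt_pow_right₀ (by norm_num) h
      have h2 := mul_lt_mul_of_pos_right h1 hE
      rw [← hd, ← hGE] at h2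
      linarith
    obtain ⟨e, he⟩ : ∃ e, N = d + e := ⟨N - d, by omega⟩
    have h2 : (2 : K) ^ N = 2 ^ d * 2 ^ e := by rw [he, pow_add]
    have hEu : ((2 ^ e : ℕ) : K) * (f / 2 ^ N) = E := by
      push_cast; rw [hd, h2]; field_simp
    have hyφ : truncQ F (probAwayA N) c ≤ resid (c - dn F c') E := by
      rw [hφ, hy, ← hEu]
      exact resid_le_resid_mul huf (by positivity)
    have hΔφ := mul_nonneg (sub_nonneg.mpr hcc.le) (sub_nonneg.mpr hyφ)
    have P8 := mul_nonneg hE.le (show 0 ≤ E - truncQ F (probAwayA N) c by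
      linarith only [hyb.2, hufE])
    have P6 := mul_nonneg hE.le (sub_nonneg.mpr hyb'.2.le)
    unfold PairLE
    rw [h0, hψ0, hψ1]
    linarith only [hcd, hΔφ, hV, hV', P8, P6]
  · -- (ii) `E = 2^m·f` with `f < E`
    have hm0 : 1 ≤ m := by
      rcases Nat.eq_zero_or_pos m with h | h
      · rw [h, pow_zero, one_mul] at hm; linarith
      · exact h
    have hfE2 : 2 * f ≤ E := by
      rw [hm]
      have : (2 : K) ≤ 2 ^ m :=
        calc (2 : K) = 2 ^ 1 := by norm_num
          _ ≤ 2 ^ m := pow_le_pow_right₀ (by norm_num) hm0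
      exact mul_le_mul_of_nonneg_right this hf.le
    obtain ⟨k, hk0, hkM, hk⟩ := resid_mul_eq_int hf (2 ^ m) (by positivity) zd
    have hψ0 : resid (dn F c - dn F c') E = (k : K) * f := by
      rw [hzd, hm]; push_cast at hk ⊢; exact hk
    have hk1 : (k : K) + 1 ≤ 2 ^ m := by
      have : k + 1 ≤ ((2 ^ m : ℕ) : ℤ) := by omega
      exact_mod_cast this
    have hψ0le : resid (dn F c - dn F c') E ≤ E - f := by
      rw [hψ0, hm]
      have := mul_le_mul_of_nonneg_right hk1 hf.le
      linarith only [this]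
    -- `φ = o + ψ₀` and `ψ₁ ≤ f + ψ₀`
    have hφ : resid (c - dn F c') E = (c - dn F c) + resid (dn F c - dn F c') E := by
      rw [show c - dn F c' = ((c - dn F c) + resid (dn F c - dn F c') E)
          + (⌊(dn F c - dn F c') / E⌋ : ℤ) * E by linear_combination hj, resid_add_mul hE]
      exact resid_eq_self hE (by linarith only [hr0.1, hdlt]) (by linarith only [hult, hu, hψ0le])
    have hψ1 : resid (dn F c + f - dn F c') E ≤ f + resid (dn F c - dn F c') E := by
      rw [show dn F c + f - dn F c' = (f + resid (dn F c - dn F c') E)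
            + (⌊(dn F c - dn F c') / E⌋ : ℤ) * E by linear_combination hj, resid_add_mul hE]
      exact resid_le_self hE (by linarith only [hr0.1, hf])
    -- `y = o − π·f`, `y ≤ f/2`, `π·f ≤ f`
    have hyo : truncQ F (probAwayA N) c = (c - dn F c) - pUpQ F (probAwayA N) c * f := by
      unfold truncQ stepQ; rw [hu]; ring
    have hyhalf : truncQ F (probAwayA N) c ≤ f / 2 := by
      have : f / 2 ^ N ≤ f / 2 := div_le_div_of_nonneg_left hf.le (by norm_num) h2N
      linarith only [hyb.2, this]
    have hπf : pUpQ F (probAwayA N) c * f ≤ f := mul_le_of_le_one_left hf.le hp1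
    have hpq0 : 0 ≤ pUpQ F (probAwayA N) c * (1 - pUpQ F (probAwayA N) c) :=
      mul_nonneg hp0 (by linarith only [hp1])
    have hVc : vslackQ F (probAwayA N) G c = G ^ 2 / 4
        - pUpQ F (probAwayA N) c * (1 - pUpQ F (probAwayA N) c) * f ^ 2 := by
      unfold vslackQ; rw [hw]
    have hS0 : 0 ≤ resid (dn F c - dn F c') E + pUpQ F (probAwayA N) c * f + E / 2 := by
      have := mul_nonneg hp0 hf.le
      linarith only [hr0.1, this, hE]
    have hS1 : resid (dn F c - dn F c') E + pUpQ F (probAwayA N) c * f + E / 2 ≤ E + E / 2 := by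
      linarith only [hψ0le, hπf]
    rw [hyo] at hyhalf hyb
    have P1 := mul_le_mul_of_nonneg_left hψ1 (mul_nonneg hp0 (sub_nonneg.mpr hMge))
    have P2 := mul_le_mul_of_nonneg_right hyhalf hS0
    have P3 := mul_le_mul_of_nonneg_left hS1 (show (0 : K) ≤ f / 2 by positivity)
    have P4 := mul_le_mul_of_nonneg_right hfE2 hE.le
    have P5 := mul_nonneg hyb'.1 (add_nonneg hr0.1 (mul_nonneg hp0 hf.le))
    have P6 := mul_nonneg hE.le (sub_nonneg.mpr hyb'.2.le)
    have P7 := mul_nonneg hpq0 (sq_nonneg f)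
    have P9 := sq_nonneg G
    have P10 := sq_nonneg E
    have hGE2 : G ^ 2 = (2 ^ N) ^ 2 * E ^ 2 := by rw [hGE]; ring
    have h4 : (4 : K) ≤ (2 ^ N) ^ 2 := by nlinarith [h2N]
    have hG4 : 4 * E ^ 2 ≤ G ^ 2 := by rw [hGE2]; nlinarith [sq_nonneg E]
    rw [hφ, hyo] at hcd
    unfold PairLE
    rw [h0, hm', hVc, hyo]
    linarith only [hcd, P1, P2, P3, P4, P5, P6, P7, P9, P10, hV', hG4]

end LimitedBits

end Summit.Ventures.CertifiedArithmetic.LowPrec.SR
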